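import Summits.CriticalPhenomena.PercolationContinuityZ3.Theorems.PercNearOneGluingNoHeavyQuantGateMoveBlob
import HarnessLib

/-!
# QUANT lane R8, T-DEC, leg (III): SDEC is closed under hanging a STAR OF PENDANT RELAYS (any gates `≥ x`) beside any law under a
# common gate — iteration of the single-relay gate move

builds on p205010 (kernel theorem, internal audit signed; external expert review pending)

Support file (`--supports stmt-CriticalPhenomena-4575`), QUANT lane typer seat prim-quant-stmt (gen 27), rung R8 of
`run/shared/lean/prim/quant/LADDER.md`.  Theorems only, standard axioms, no sorries, no definitions.  Iterates typer g27's
`LawDec.sdecUpTo_slice_relay` (`…QuantGateMoveBlob`): slicing by one relay `{0,1;g}` with `x ≤ g ≤ 1` keeps "top-affordable probability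
law, SDEC up to `Q` at floor `x`"; hence so does slicing by any finite list of such relays, i.e. convolution with the law of a sum of
INDEPENDENT Bernoulli relays with gates in `[x, 1]` (a star of pendant leaves hung beside the subtree under the common gate).  Together
with Conjecture R (sure relays, typer g26) and the dominated blobs (lead g27) this is the unconditional part of leg (III) to date; the
general blob `{0,a;g}` with `a ≥ 2`, `g < 1 − μ 0` and the general empty-free factor (`GatedConvEmptyFree` / `GateMove` /
`SingleGateConvClosed`) remain OPEN.

* `LawDec.relaySlices μ gs` — notation-free helper written as `List.foldr`: not a definition, the statements use the `foldr` term directly.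
* **`LawDec.sdecUpTo_slice_relays`** — for `gs : List ℝ` with `x ≤ g ≤ 1` for all `g ∈ gs`:
  `SDECUpTo x Q M μ → SDECUpTo x Q (M + gs.length) (gs.foldr (fun g L => slice L 1 g) μ)` (with the law facts carried along);
  `LawDec.sdec_slice_relays` (`Q = 1`).

[this work]; single relay: typer g27; R: typer g25–g26; dominated blobs: lead g27 (this lane).  The gluing rows served
[cite: KozmaNitzan2024, Conjecture 3 (p. 15)]; product measure [cite: Grimmett1999, §1.3 p. 10].
-/

noncomputable section

namespace Summit.CriticalPhenomena.PercolationContinuityZ3.Theorems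

namespace Quant

open Finset

namespace LawDec

/-- **law facts are kept by slicing with one relay**: `slice μ 1 g` (`0 ≤ g ≤ 1`) is a probability law on `{0..M+1}` with mean
`T + g`; if `x ≤ g` and `x·M ≤ T` then `x·(M+1) ≤ T + g`. [this work] -/
theorem slice_relay_laws (x g : ℝ) (M : ℕ) (μ : ℕ → ℝ) (hg0 : 0 ≤ g) (hg1 : g ≤ 1) (hxg : x ≤ g)
    (hμ0 : ∀ h, 0 ≤ μ h) (hμM : ∀ h, M < h → μ h = 0) (hμ1 : ∑ h ∈ Finset.range (M + 1), μ h = 1)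
    (hta : x * (M : ℝ) ≤ ∑ h ∈ Finset.range (M + 1), (h : ℝ) * μ h) :
    (∀ h, 0 ≤ slice μ 1 g h) ∧ (∀ h, M + 1 < h → slice μ 1 g h = 0) ∧
    (∑ h ∈ Finset.range (M + 1 + 1), slice μ 1 g h = 1) ∧
    x * ((M + 1 : ℕ) : ℝ) ≤ ∑ h ∈ Finset.range (M + 1 + 1), (h : ℝ) * slice μ 1 g h := by
  refine ⟨fun h => slice_nonneg μ 1 g hg0 hg1 hμ0 h, fun h hh => slice_eq_zero μ 1 g M hμM h hh,
    sum_slice μ 1 g M hμM hμ1, ?_⟩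
  rw [sum_mul_slice μ 1 g M hμM hμ1]
  push_cast
  linarith

/-- **SDEC-UP-TO-`Q` IS CLOSED UNDER SLICING BY A LIST OF RELAYS** (`x ≤ g ≤ 1` for every gate in the list): by induction on the list,
each step being `sdecUpTo_slice_relay` with the law facts of `slice_relay_laws`.  The conclusion carries the law facts along so that the
induction closes. [this work] -/
theorem sdecUpTo_slice_relays (x Q : ℝ) (hx0 : 0 < x) (hQ1 : Q ≤ 1) (hQx : Q * x < 1) (gs : List ℝ)
    (hgs : ∀ g ∈ gs, x ≤ g ∧ g ≤ 1) :
    ∀ (M : ℕ) (μ : ℕ → ℝ), (∀ h, 0 ≤ μ h) → (∀ h, M < h → μ h = 0) → (∑ h ∈ Finset.range (M + 1), μ h = 1) →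
      x * (M : ℝ) ≤ ∑ h ∈ Finset.range (M + 1), (h : ℝ) * μ h → SDECUpTo x Q M μ →
      (∀ h, 0 ≤ gs.foldr (fun g L => slice L 1 g) μ h) ∧
      (∀ h, M + gs.length < h → gs.foldr (fun g L => slice L 1 g) μ h = 0) ∧
      (∑ h ∈ Finset.range (M + gs.length + 1), gs.foldr (fun g L => slice L 1 g) μ h = 1) ∧
      (x * ((M + gs.length : ℕ) : ℝ) ≤ ∑ h ∈ Finset.range (M + gs.length + 1), (h : ℝ) * gs.foldr (fun g L => slice L 1 g) μ h) ∧
      SDECUpTo x Q (M + gs.length) (gs.foldr (fun g L => slice L 1 g) μ) := by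
  induction gs with
  | nil =>
    intro M μ hμ0 hμM hμ1 hta hS
    simp only [List.foldr_nil, List.length_nil, Nat.add_zero]
    exact ⟨hμ0, hμM, hμ1, hta, hS⟩
  | cons g gs ih =>
    intro M μ hμ0 hμM hμ1 hta hS
    have hg : x ≤ g ∧ g ≤ 1 := hgs g (by simp)
    have hgs' : ∀ g' ∈ gs, x ≤ g' ∧ g' ≤ 1 := fun g' hg' => hgs g' (List.mem_cons_of_mem g hg')
    obtain ⟨l0, lM, l1, lta, lS⟩ := ih hgs' M μ hμ0 hμM hμ1 hta hS
    set L : ℕ → ℝ := gs.foldr (fun g L => slice L 1 g) μ with hL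
    have hg0 : 0 ≤ g := hx0.le.trans hg.1
    obtain ⟨s0, sM, s1, sta⟩ := slice_relay_laws x g (M + gs.length) L hg0 hg.2 hg.1 l0 lM l1 lta
    have e : (g :: gs).foldr (fun g L => slice L 1 g) μ = slice L 1 g := by simp only [List.foldr_cons, hL]
    have elen : M + (g :: gs).length = M + gs.length + 1 := by simp only [List.length_cons]; omega
    rw [e, elen]
    exact ⟨s0, sM, s1, sta, sdecUpTo_slice_relay x Q g (M + gs.length) L hx0 hQ1 hQx hg.1 hg.2 l0 lM l1 lta lS⟩

/-- **SDEC IS CLOSED UNDER CONVOLUTION WITH THE LAW OF ANY FINITE SUM OF INDEPENDENT BERNOULLI RELAYS with gates in `[x, 1]`**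
(`0 < x < 1`): the `Q = 1` case — a star of pendant leaves hung beside any top-affordable SDEC subtree under a common gate keeps SDEC.
[this work] -/
theorem sdec_slice_relays (x : ℝ) (hx0 : 0 < x) (hx1 : x < 1) (gs : List ℝ) (hgs : ∀ g ∈ gs, x ≤ g ∧ g ≤ 1)
    (M : ℕ) (μ : ℕ → ℝ) (hμ0 : ∀ h, 0 ≤ μ h) (hμM : ∀ h, M < h → μ h = 0)
    (hμ1 : ∑ h ∈ Finset.range (M + 1), μ h = 1) (hta : x * (M : ℝ) ≤ ∑ h ∈ Finset.range (M + 1), (h : ℝ) * μ h)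
    (hS : SDEC x M μ) :
    SDEC x (M + gs.length) (gs.foldr (fun g L => slice L 1 g) μ) := by
  rw [← sdecUpTo_one_iff] at hS ⊢
  exact (sdecUpTo_slice_relays x 1 hx0 le_rfl (by rwa [one_mul]) gs hgs M μ hμ0 hμM hμ1 hta hS).2.2.2.2

end LawDec

end Quant

end Summit.CriticalPhenomena.PercolationContinuityZ3.Theorems
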